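import Mathlib
import HarnessLib
import Summits.NavierStokesRegularity.NavierStokesRegularity.Theorems.TaylorModelRungThreeReadoutFlowV

/-!
# Line `taylor-model` on crux K1b-DR (stmt-NavierStokesRegularity-23954) — (E) flow-side consumer of the vector
# step, part 2: FIRST DIFFERENCES of the selector flow — node-set starts along the centre trajectory (F3′a, F5′-diff)
# and κ-RESTARTS along a tube trajectory (F3′b)

Continuation of `…ReadoutFlowV` (hypotheses = certificate clauses in cascade coordinates, explicit).  Everything
rests on `exists_diff_sol_mem_Icc_along` (VECTOR-LEMMAS part 12): along a KNOWN confined solution, the difference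
test (D1) alone gives the second trajectory and confines the difference — no rough-enclosure test at the second start
point, hence no start hull and no wrapping.

* `isSolOn_shift` — a solution on `[0,T]` restarted at time `u₀` is a solution on `[0, T − u₀]`;
* (F3′a) `solvesOn_liftFlowSel_of_diffTest`, `diff_bounds_liftFlowSel_of_diffTest` — for a start `z` whose
  difference `z − x` to the centre passes (D1) along the centre's box: the selector flow from `z` solves on `[0,h]`
  and `φ(z,u) − φ(x,u)` has window bounds in `[loD, hiD]`;
* (F5′-diff) `diffTaylor_liftFlowSel_of_diffTest` — with a jet-DIFFERENCE enclosure `JD` over the boxes,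
  `|(φ(z,u) − φ(x,u)) − Σ_{n≤p} (taylorJet cd.Qb z n − taylorJet cd.Qb x n)·u^n|_{ik} ≤ JD i k · u^(p+1)`;
* (F3′b) `solvesOn_liftFlowSel_restart`, `diff_bounds_liftFlowSel_restart` — for ANY `w` whose selector
  trajectory solves on `[0,h]` inside a box `[tlo,thi]`, a state `z` with `z − φ(w,u₀) ∈ Ball_j(κ)` and the κ-difference
  test over that box: the selector flow from `z` solves on `[0, h − u₀]` and `φ(z,u) − φ(w,u₀+u)` has window bounds in
  `[loK, hiK]`.

MODEL-lattice rung TL-M3 only; nothing here is a statement about the Navier–Stokes equations.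
-/

noncomputable section

-- the sub-problem namespace repeats the summit name by design (D-0017)
set_option linter.dupNamespace false

namespace Summit.NavierStokesRegularity.NavierStokesRegularity.Theorems.TaylorModelReadout

open Set Finset
open Literature.Analysis.FluidPDE.TaoCascade Literature.Analysis.FluidPDE.TaoCascade.TaylorChain
open Summit.NavierStokesRegularity.NavierStokesRegularity.Theorems.TaylorModelMajorant
open Summit.NavierStokesRegularity.NavierStokesRegularity.Theorems.TaylorModelVector

variable {cd : CertData}

/-! ### Restarting a solution -/

/-- A solution on `[0,T]`, restarted at time `u₀ ∈ [0,T]`, is a solution on `[0, T − u₀]` from its value at `u₀`.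
[folklore] -/
theorem isSolOn_shift {n : ℕ} {Q : (Fin n → ℝ) → (Fin n → ℝ) → Fin n → ℝ} {x : Fin n → ℝ} {T u₀ : ℝ}
    {ψ : ℝ → Fin n → ℝ} (hψ : IsSolOn Q x T ψ) (hu₀ : u₀ ∈ Icc 0 T) :
    IsSolOn Q (ψ u₀) (T - u₀) (fun s => ψ (u₀ + s)) := by
  refine ⟨by simp, fun s hs => ?_⟩
  have hmem : u₀ + s ∈ Icc 0 T := ⟨by linarith [hu₀.1, hs.1], by linarith [hs.2]⟩
  have h1 := hψ.2 (u₀ + s) hmem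
  have h2 : HasDerivWithinAt (fun s : ℝ => u₀ + s) 1 (Icc 0 (T - u₀)) s :=
    (hasDerivWithinAt_id s _).const_add u₀
  have hmaps : MapsTo (fun s : ℝ => u₀ + s) (Icc 0 (T - u₀)) (Icc 0 T) :=
    fun r hr => ⟨by linarith [hu₀.1, hr.1], by linarith [hr.2]⟩
  have h3 : HasDerivWithinAt (ψ ∘ fun s : ℝ => u₀ + s) ((1:ℝ) • Q (ψ (u₀ + s)) (ψ (u₀ + s)))
      (Icc 0 (T - u₀)) s := h1.scomp s h2 hmaps
  rw [one_smul] at h3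
  exact h3

/-! ### (F3′a) node-set starts: the difference test along the centre trajectory -/

section Diff

variable {j : ℕ} {lo hi x loD hiD z : Fin 4 → ℤ → ℝ} {h : ℝ}

/-- The second trajectory and the confined difference, in window coordinates (internal form). [folklore] -/
theorem exists_diff_flowSel_of_diffTest
    (hMS : IsMajorantSystem (nW cd) (Qw cd) (wW cd j) (cd.bb j) (taylorJet (Qw cd)) (varJet (Qw cd)))
    (hh : 0 ≤ h) (hx : ∀ i k, -cd.Kb ≤ k → k ≤ cd.Ka → lo i k ≤ x i k ∧ x i k ≤ hi i k)
    (henc : ∀ y : Fin 4 → ℤ → ℝ, (∀ i k, -cd.Kb ≤ k → k ≤ cd.Ka → lo i k ≤ y i k ∧ y i k ≤ hi i k) →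
      ∀ u ∈ Icc (0:ℝ) h, ∀ i k, -cd.Kb ≤ k → k ≤ cd.Ka →
        lo i k ≤ (x + u • cd.Qb y y) i k ∧ (x + u • cd.Qb y y) i k ≤ hi i k)
    (hz : ∀ i k, -cd.Kb ≤ k → k ≤ cd.Ka → loD i k ≤ (z - x) i k ∧ (z - x) i k ≤ hiD i k)
    (hencD : ∀ y d : Fin 4 → ℤ → ℝ, (∀ i k, -cd.Kb ≤ k → k ≤ cd.Ka → lo i k ≤ y i k ∧ y i k ≤ hi i k) →
      (∀ i k, -cd.Kb ≤ k → k ≤ cd.Ka → loD i k ≤ d i k ∧ d i k ≤ hiD i k) → ∀ u ∈ Icc (0:ℝ) h,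
        ∀ i k, -cd.Kb ≤ k → k ≤ cd.Ka →
          loD i k ≤ ((z - x) + u • (cd.Qb y d + cd.Qb d y + cd.Qb d d)) i k ∧
          ((z - x) + u • (cd.Qb y d + cd.Qb d y + cd.Qb d d)) i k ≤ hiD i k) :
    IsSolOn (Qw cd) (toVec cd z) h (fun s => flowSel (Qw cd) (toVec cd z) s) ∧
      (∀ s ∈ Icc 0 h, flowSel (Qw cd) (toVec cd x) s ∈ Icc (toVec cd lo) (toVec cd hi)) ∧
      ∀ s ∈ Icc 0 h, flowSel (Qw cd) (toVec cd z) s - flowSel (Qw cd) (toVec cd x) s ∈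
        Icc (toVec cd loD) (toVec cd hiD) := by
  obtain ⟨Qb, hQb⟩ := exists_bundle hMS
  obtain ⟨hsolx, hboxx⟩ := flowSel_isSolOn_mem_Icc hMS (toVec_mem_Icc_of_bounds (cd := cd) hx) hh
    (roughEnclosure_toVec henc)
  have hψ : ∀ s ∈ Icc 0 h, HasDerivWithinAt (fun s => flowSel (Qw cd) (toVec cd x) s)
      (Qb (flowSel (Qw cd) (toVec cd x) s) (flowSel (Qw cd) (toVec cd x) s)) (Icc 0 h) s := by
    simpa only [hQb] using hsolx.2
  have hd₀ : toVec cd z - toVec cd x ∈ Icc (toVec cd loD) (toVec cd hiD) := by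
    rw [← toVec_sub]; exact toVec_mem_Icc_of_bounds (cd := cd) hz
  have hencD' : ∀ yv ∈ Icc (toVec cd lo) (toVec cd hi), ∀ dv ∈ Icc (toVec cd loD) (toVec cd hiD),
      ∀ u ∈ Icc (0:ℝ) h, (toVec cd z - toVec cd x) + u • (Qb yv dv + Qb dv yv + Qb dv dv) ∈
        Icc (toVec cd loD) (toVec cd hiD) := by
    intro yv hyv dv hdv u hu
    have h1 := hencD (ofVec cd yv) (ofVec cd dv) (ofVec_window_bounds (cd := cd) hyv)
      (ofVec_window_bounds (cd := cd) hdv) u hu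
    have h2 := toVec_mem_Icc_of_bounds (cd := cd) h1
    rw [toVec_add, toVec_smul, toVec_sub, toVec_add, toVec_add] at h2
    simpa [hQb, Qw] using h2
  obtain ⟨ψ', h0', hder', hbox'⟩ := exists_diff_sol_mem_Icc_along Qb hh hψ hboxx hd₀ hencD'
  rw [flowSel_zero, add_sub_cancel] at h0'
  have hsolz : IsSolOn (Qw cd) (toVec cd z) h ψ' := ⟨h0', by simpa only [hQb] using hder'⟩
  have heq : ∀ s ∈ Icc 0 h, flowSel (Qw cd) (toVec cd z) s = ψ' s := fun s hs => hMS.flowSel_eq hsolz hs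
  refine ⟨⟨flowSel_zero _, fun s hs => ?_⟩, hboxx, fun s hs => by rw [heq s hs]; exact hbox' s hs⟩
  show HasDerivWithinAt (fun s => flowSel (Qw cd) (toVec cd z) s)
    (Qw cd (flowSel (Qw cd) (toVec cd z) s) (flowSel (Qw cd) (toVec cd z) s)) (Icc 0 h) s
  rw [heq s hs]
  exact (hsolz.2 s hs).congr (fun σ hσ => heq σ hσ) (heq s hs)

/-- **(F3′a, existence)** A node-set start `z` whose difference to the centre passes the test (D1): the selector flow
from `z` solves K1b-DR's ODE clause on `[0,h]`. [folklore] -/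
theorem solvesOn_liftFlowSel_of_diffTest
    (hMS : IsMajorantSystem (nW cd) (Qw cd) (wW cd j) (cd.bb j) (taylorJet (Qw cd)) (varJet (Qw cd)))
    (hh : 0 ≤ h) (hx : ∀ i k, -cd.Kb ≤ k → k ≤ cd.Ka → lo i k ≤ x i k ∧ x i k ≤ hi i k)
    (henc : ∀ y : Fin 4 → ℤ → ℝ, (∀ i k, -cd.Kb ≤ k → k ≤ cd.Ka → lo i k ≤ y i k ∧ y i k ≤ hi i k) →
      ∀ u ∈ Icc (0:ℝ) h, ∀ i k, -cd.Kb ≤ k → k ≤ cd.Ka →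
        lo i k ≤ (x + u • cd.Qb y y) i k ∧ (x + u • cd.Qb y y) i k ≤ hi i k)
    (hz : ∀ i k, -cd.Kb ≤ k → k ≤ cd.Ka → loD i k ≤ (z - x) i k ∧ (z - x) i k ≤ hiD i k)
    (hencD : ∀ y d : Fin 4 → ℤ → ℝ, (∀ i k, -cd.Kb ≤ k → k ≤ cd.Ka → lo i k ≤ y i k ∧ y i k ≤ hi i k) →
      (∀ i k, -cd.Kb ≤ k → k ≤ cd.Ka → loD i k ≤ d i k ∧ d i k ≤ hiD i k) → ∀ u ∈ Icc (0:ℝ) h,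
        ∀ i k, -cd.Kb ≤ k → k ≤ cd.Ka →
          loD i k ≤ ((z - x) + u • (cd.Qb y d + cd.Qb d y + cd.Qb d d)) i k ∧
          ((z - x) + u • (cd.Qb y d + cd.Qb d y + cd.Qb d d)) i k ≤ hiD i k) :
    SolvesOn cd (fun _ => liftFlow cd (fun x s => flowSel (Qw cd) x s)) j z h := by
  have hsol := (exists_diff_flowSel_of_diffTest hMS hh hx henc hz hencD).1
  intro i k hk1 hk2
  have hk : -cd.Kb ≤ k ∧ k ≤ cd.Ka := ⟨hk1, hk2⟩
  refine ⟨liftFlowSel_zero z i hk, fun t' ht' => ?_⟩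
  set c : Fin (nW cd) := eW cd (i, ⟨k, Finset.mem_Icc.2 hk⟩) with hc
  have hcomp : HasDerivWithinAt (fun s => flowSel (Qw cd) (toVec cd z) s c)
      (Qw cd (flowSel (Qw cd) (toVec cd z) t') (flowSel (Qw cd) (toVec cd z) t') c) (Icc 0 h) t' :=
    (hasDerivWithinAt_pi.1 (hsol.2 t' ht')) c
  have hfun : (fun s => liftFlow cd (fun x s => flowSel (Qw cd) x s) z i k s) =
      fun s => flowSel (Qw cd) (toVec cd z) s c := by
    funext s; rw [liftFlow_of_mem z i hk]
  rw [show (fun _ => liftFlow cd (fun x s => flowSel (Qw cd) x s)) j z i k =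
      fun s => liftFlow cd (fun x s => flowSel (Qw cd) x s) z i k s from rfl, hfun]
  convert hcomp using 1
  rw [quadTerm_trunc_eq_qT (cd := cd) _ i hk, qT_eq_Qw_apply (cd := cd) _ i hk]
  congr 1 <;>
  · funext c'
    simp only [toVec]
    rw [liftFlow_of_mem _ _ (shellOf_mem cd c')]
    congr 1
    exact (Equiv.apply_symm_apply (eW cd) c')

/-- **(F3′a, confinement)** … and the difference of the two selector trajectories has window bounds in
`[loD, hiD]` on `[0,h]`. [folklore] -/
theorem diff_bounds_liftFlowSel_of_diffTest
    (hMS : IsMajorantSystem (nW cd) (Qw cd) (wW cd j) (cd.bb j) (taylorJet (Qw cd)) (varJet (Qw cd)))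
    (hh : 0 ≤ h) (hx : ∀ i k, -cd.Kb ≤ k → k ≤ cd.Ka → lo i k ≤ x i k ∧ x i k ≤ hi i k)
    (henc : ∀ y : Fin 4 → ℤ → ℝ, (∀ i k, -cd.Kb ≤ k → k ≤ cd.Ka → lo i k ≤ y i k ∧ y i k ≤ hi i k) →
      ∀ u ∈ Icc (0:ℝ) h, ∀ i k, -cd.Kb ≤ k → k ≤ cd.Ka →
        lo i k ≤ (x + u • cd.Qb y y) i k ∧ (x + u • cd.Qb y y) i k ≤ hi i k)
    (hz : ∀ i k, -cd.Kb ≤ k → k ≤ cd.Ka → loD i k ≤ (z - x) i k ∧ (z - x) i k ≤ hiD i k)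
    (hencD : ∀ y d : Fin 4 → ℤ → ℝ, (∀ i k, -cd.Kb ≤ k → k ≤ cd.Ka → lo i k ≤ y i k ∧ y i k ≤ hi i k) →
      (∀ i k, -cd.Kb ≤ k → k ≤ cd.Ka → loD i k ≤ d i k ∧ d i k ≤ hiD i k) → ∀ u ∈ Icc (0:ℝ) h,
        ∀ i k, -cd.Kb ≤ k → k ≤ cd.Ka →
          loD i k ≤ ((z - x) + u • (cd.Qb y d + cd.Qb d y + cd.Qb d d)) i k ∧
          ((z - x) + u • (cd.Qb y d + cd.Qb d y + cd.Qb d d)) i k ≤ hiD i k) :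
    ∀ u ∈ Icc 0 h, ∀ i k, -cd.Kb ≤ k → k ≤ cd.Ka →
      loD i k ≤ (stAt (fun _ => liftFlow cd (fun x s => flowSel (Qw cd) x s)) j z u -
          stAt (fun _ => liftFlow cd (fun x s => flowSel (Qw cd) x s)) j x u) i k ∧
      (stAt (fun _ => liftFlow cd (fun x s => flowSel (Qw cd) x s)) j z u -
          stAt (fun _ => liftFlow cd (fun x s => flowSel (Qw cd) x s)) j x u) i k ≤ hiD i k := by
  intro u hu
  have hbox := (exists_diff_flowSel_of_diffTest hMS hh hx henc hz hencD).2.2 u hu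
  rw [stAt_liftFlow, stAt_liftFlow, ← ofVec_sub]
  exact ofVec_window_bounds (cd := cd) hbox

/-- **(F5′-diff)** With a jet-DIFFERENCE enclosure of order `p+1` over the state box × difference box, the
componentwise remainder of the first difference against the exact jet differences. [folklore] -/
theorem diffTaylor_liftFlowSel_of_diffTest
    (hMS : IsMajorantSystem (nW cd) (Qw cd) (wW cd j) (cd.bb j) (taylorJet (Qw cd)) (varJet (Qw cd)))
    (hh : 0 ≤ h) (hx : ∀ i k, -cd.Kb ≤ k → k ≤ cd.Ka → lo i k ≤ x i k ∧ x i k ≤ hi i k)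
    (henc : ∀ y : Fin 4 → ℤ → ℝ, (∀ i k, -cd.Kb ≤ k → k ≤ cd.Ka → lo i k ≤ y i k ∧ y i k ≤ hi i k) →
      ∀ u ∈ Icc (0:ℝ) h, ∀ i k, -cd.Kb ≤ k → k ≤ cd.Ka →
        lo i k ≤ (x + u • cd.Qb y y) i k ∧ (x + u • cd.Qb y y) i k ≤ hi i k)
    (hz : ∀ i k, -cd.Kb ≤ k → k ≤ cd.Ka → loD i k ≤ (z - x) i k ∧ (z - x) i k ≤ hiD i k)
    (hencD : ∀ y d : Fin 4 → ℤ → ℝ, (∀ i k, -cd.Kb ≤ k → k ≤ cd.Ka → lo i k ≤ y i k ∧ y i k ≤ hi i k) →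
      (∀ i k, -cd.Kb ≤ k → k ≤ cd.Ka → loD i k ≤ d i k ∧ d i k ≤ hiD i k) → ∀ u ∈ Icc (0:ℝ) h,
        ∀ i k, -cd.Kb ≤ k → k ≤ cd.Ka →
          loD i k ≤ ((z - x) + u • (cd.Qb y d + cd.Qb d y + cd.Qb d d)) i k ∧
          ((z - x) + u • (cd.Qb y d + cd.Qb d y + cd.Qb d d)) i k ≤ hiD i k)
    {p : ℕ} {JD : Fin 4 → ℤ → ℝ}
    (hJD : ∀ y d : Fin 4 → ℤ → ℝ, (∀ i k, -cd.Kb ≤ k → k ≤ cd.Ka → lo i k ≤ y i k ∧ y i k ≤ hi i k) →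
      (∀ i k, -cd.Kb ≤ k → k ≤ cd.Ka → loD i k ≤ d i k ∧ d i k ≤ hiD i k) →
      ∀ i k, -cd.Kb ≤ k → k ≤ cd.Ka →
        |taylorJet cd.Qb (y + d) (p + 1) i k - taylorJet cd.Qb y (p + 1) i k| ≤ JD i k) :
    ∀ u ∈ Icc 0 h, ∀ i k, -cd.Kb ≤ k → k ≤ cd.Ka →
      |(stAt (fun _ => liftFlow cd (fun x s => flowSel (Qw cd) x s)) j z u -
          stAt (fun _ => liftFlow cd (fun x s => flowSel (Qw cd) x s)) j x u) i k
        - ∑ n ∈ Finset.range (p + 1), (taylorJet cd.Qb z n i k - taylorJet cd.Qb x n i k) * u ^ n|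
        ≤ JD i k * u ^ (p + 1) := by
  obtain ⟨Qb, hQb⟩ := exists_bundle hMS
  obtain ⟨hsolz, hboxx, hboxd⟩ := exists_diff_flowSel_of_diffTest hMS hh hx henc hz hencD
  have hsolx := (flowSel_isSolOn_mem_Icc hMS (toVec_mem_Icc_of_bounds (cd := cd) hx) hh
    (roughEnclosure_toVec henc)).1
  have hTs : ∀ x (k : ℕ) c, ((k : ℝ) + 1) * taylorJet (Qw cd) x (k + 1) c =
      ∑ i ∈ Finset.range (k + 1), Qb (taylorJet (Qw cd) x i) (taylorJet (Qw cd) x (k - i)) c := by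
    simpa only [hQb] using hMS.T_succ
  have hψ : ∀ s ∈ Icc 0 h, HasDerivWithinAt (fun s => flowSel (Qw cd) (toVec cd x) s)
      (Qb (flowSel (Qw cd) (toVec cd x) s) (flowSel (Qw cd) (toVec cd x) s)) (Icc 0 h) s := by
    simpa only [hQb] using hsolx.2
  have hψ' : ∀ s ∈ Icc 0 h, HasDerivWithinAt (fun s => flowSel (Qw cd) (toVec cd z) s)
      (Qb (flowSel (Qw cd) (toVec cd z) s) (flowSel (Qw cd) (toVec cd z) s)) (Icc 0 h) s := by
    simpa only [hQb] using hsolz.2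
  have hJ' : ∀ yv ∈ Icc (toVec cd lo) (toVec cd hi), ∀ dv ∈ Icc (toVec cd loD) (toVec cd hiD), ∀ c',
      |taylorJet (Qw cd) (yv + dv) (p + 1) c' - taylorJet (Qw cd) yv (p + 1) c'| ≤ toVec cd JD c' := by
    intro yv hyv dv hdv c'
    have h1 := hJD (ofVec cd yv) (ofVec cd dv) (ofVec_window_bounds (cd := cd) hyv)
      (ofVec_window_bounds (cd := cd) hdv) (modeOf cd c') (shellOf cd c') (shellOf_mem cd c').1 (shellOf_mem cd c').2
    have h2 := congrFun (toVec_taylorJet (cd := cd) (ofVec cd yv + ofVec cd dv) (p + 1)) c'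
    have h3 := congrFun (toVec_taylorJet (cd := cd) (ofVec cd yv) (p + 1)) c'
    rw [toVec_add, toVec_ofVec, toVec_ofVec] at h2
    rw [toVec_ofVec] at h3
    simp only [toVec] at h2 h3 ⊢
    rw [← h2, ← h3]
    exact h1
  intro u hu i k hk1 hk2
  have hk : -cd.Kb ≤ k ∧ k ≤ cd.Ka := ⟨hk1, hk2⟩
  set c : Fin (nW cd) := eW cd (i, ⟨k, Finset.mem_Icc.2 hk⟩) with hc
  have key := abs_diff_sub_taylor_le_of_mem_Icc Qb hMS.T_zero hTs hψ hψ' hboxx hboxd hJ' u hu c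
  rw [flowSel_zero, flowSel_zero] at key
  rw [stAt_liftFlow, stAt_liftFlow, ← ofVec_sub, ofVec_apply_of_mem cd _ i hk]
  have e1 : ∀ (y : Fin 4 → ℤ → ℝ) n, taylorJet (Qw cd) (toVec cd y) n c = taylorJet cd.Qb y n i k := by
    intro y n
    rw [← toVec_taylorJet]
    simp [toVec, hc, modeOf, shellOf]
  have e2 : toVec cd JD c = JD i k := by simp [toVec, hc, modeOf, shellOf]
  simp only [e1, e2] at key
  exact key

end Diff

/-! ### (F3′b) κ-restarts along a tube trajectory -/

section Restart

variable {j : ℕ} {tlo thi loK hiK w z : Fin 4 → ℤ → ℝ} {h u₀ : ℝ}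

/-- A cascade-side `SolvesOn` of the selector flow gives the window-side `IsSolOn` of the selector. [folklore] -/
theorem isSolOn_flowSel_of_solvesOn
    (hw : SolvesOn cd (fun _ => liftFlow cd (fun x s => flowSel (Qw cd) x s)) j w h) :
    IsSolOn (Qw cd) (toVec cd w) h (fun s => flowSel (Qw cd) (toVec cd w) s) := by
  have h1 := isSolOn_toVec_of_solves (cd := cd) (z := w) (T := h)
    (ψ := fun i k s => liftFlow cd (fun x s => flowSel (Qw cd) x s) w i k s) hw
  have e : (fun s => toVec cd fun i k => liftFlow cd (fun x s => flowSel (Qw cd) x s) w i k s) =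
      fun s => flowSel (Qw cd) (toVec cd w) s := by
    funext s
    have h2 := stAt_liftFlow (cd := cd) (Φ := fun x s => flowSel (Qw cd) x s) j w s
    have h3 := congrArg (toVec cd) h2
    rw [toVec_ofVec] at h3
    exact h3
  rw [e] at h1
  exact h1

/-- The restarted trajectory and its confined difference, in window coordinates (internal form). [folklore] -/
theorem exists_restart_flowSel
    (hMS : IsMajorantSystem (nW cd) (Qw cd) (wW cd j) (cd.bb j) (taylorJet (Qw cd)) (varJet (Qw cd)))
    (hu₀ : u₀ ∈ Icc 0 h) (hw : IsSolOn (Qw cd) (toVec cd w) h (fun s => flowSel (Qw cd) (toVec cd w) s))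
    (htube : ∀ s ∈ Icc 0 h, flowSel (Qw cd) (toVec cd w) s ∈ Icc (toVec cd tlo) (toVec cd thi))
    (hz : cd.InBall j (z - ofVec cd (flowSel (Qw cd) (toVec cd w) u₀)) (cd.κ j))
    (hKκ : ∀ i k, -cd.Kb ≤ k → k ≤ cd.Ka → loK i k ≤ -(cd.κ j * cd.ω j k) ∧ cd.κ j * cd.ω j k ≤ hiK i k)
    (hencK : ∀ d₀ : Fin 4 → ℤ → ℝ, cd.InBall j d₀ (cd.κ j) → ∀ y d : Fin 4 → ℤ → ℝ,
      (∀ i k, -cd.Kb ≤ k → k ≤ cd.Ka → tlo i k ≤ y i k ∧ y i k ≤ thi i k) →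
      (∀ i k, -cd.Kb ≤ k → k ≤ cd.Ka → loK i k ≤ d i k ∧ d i k ≤ hiK i k) → ∀ u ∈ Icc (0:ℝ) h,
        ∀ i k, -cd.Kb ≤ k → k ≤ cd.Ka →
          loK i k ≤ (d₀ + u • (cd.Qb y d + cd.Qb d y + cd.Qb d d)) i k ∧
          (d₀ + u • (cd.Qb y d + cd.Qb d y + cd.Qb d d)) i k ≤ hiK i k) :
    IsSolOn (Qw cd) (toVec cd z) (h - u₀) (fun s => flowSel (Qw cd) (toVec cd z) s) ∧
      ∀ s ∈ Icc 0 (h - u₀), flowSel (Qw cd) (toVec cd z) s - flowSel (Qw cd) (toVec cd w) (u₀ + s) ∈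
        Icc (toVec cd loK) (toVec cd hiK) := by
  obtain ⟨Qb, hQb⟩ := exists_bundle hMS
  have hh' : 0 ≤ h - u₀ := by linarith [hu₀.2]
  have hshift := isSolOn_shift hw hu₀
  have hψ : ∀ s ∈ Icc 0 (h - u₀), HasDerivWithinAt (fun s => flowSel (Qw cd) (toVec cd w) (u₀ + s))
      (Qb (flowSel (Qw cd) (toVec cd w) (u₀ + s)) (flowSel (Qw cd) (toVec cd w) (u₀ + s))) (Icc 0 (h - u₀)) s := by
    simpa only [hQb] using hshift.2
  have hbox : ∀ s ∈ Icc 0 (h - u₀), flowSel (Qw cd) (toVec cd w) (u₀ + s) ∈ Icc (toVec cd tlo) (toVec cd thi) :=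
    fun s hs => htube (u₀ + s) ⟨by linarith [hu₀.1, hs.1], by linarith [hs.2]⟩
  set d₀ : Fin 4 → ℤ → ℝ := z - ofVec cd (flowSel (Qw cd) (toVec cd w) u₀) with hd₀
  have hd₀v : toVec cd d₀ = toVec cd z - flowSel (Qw cd) (toVec cd w) u₀ := by
    rw [hd₀, toVec_sub, toVec_ofVec]
  have hd₀mem : toVec cd d₀ ∈ Icc (toVec cd loK) (toVec cd hiK) := by
    have h1 := (inBall_iff_toVec cd j d₀ (cd.κ j)).1 hz
    refine ⟨fun c => ?_, fun c => ?_⟩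
    · have h2 := (hKκ (modeOf cd c) (shellOf cd c) (shellOf_mem cd c).1 (shellOf_mem cd c).2).1
      have h3 := (abs_le.1 (h1 c)).1
      simp only [toVec, wW] at h2 h3 ⊢
      linarith
    · have h2 := (hKκ (modeOf cd c) (shellOf cd c) (shellOf_mem cd c).1 (shellOf_mem cd c).2).2
      have h3 := (abs_le.1 (h1 c)).2
      simp only [toVec, wW] at h2 h3 ⊢
      linarith
  have hencD' : ∀ yv ∈ Icc (toVec cd tlo) (toVec cd thi), ∀ dv ∈ Icc (toVec cd loK) (toVec cd hiK),
      ∀ u ∈ Icc (0:ℝ) (h - u₀), toVec cd d₀ + u • (Qb yv dv + Qb dv yv + Qb dv dv) ∈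
        Icc (toVec cd loK) (toVec cd hiK) := by
    intro yv hyv dv hdv u hu
    have h1 := hencK d₀ hz (ofVec cd yv) (ofVec cd dv) (ofVec_window_bounds (cd := cd) hyv)
      (ofVec_window_bounds (cd := cd) hdv) u ⟨hu.1, hu.2.trans (by linarith [hu₀.1])⟩
    have h2 := toVec_mem_Icc_of_bounds (cd := cd) h1
    rw [toVec_add, toVec_smul, toVec_add, toVec_add] at h2
    simpa [hQb, Qw] using h2
  rw [hd₀v] at hd₀mem hencD'
  obtain ⟨ψ', h0', hder', hbox'⟩ := exists_diff_sol_mem_Icc_along Qb hh' hψ hbox hd₀mem hencD'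
  simp only [add_zero, add_sub_cancel] at h0'
  have hsolz : IsSolOn (Qw cd) (toVec cd z) (h - u₀) ψ' := ⟨h0', by simpa only [hQb] using hder'⟩
  have heq : ∀ s ∈ Icc 0 (h - u₀), flowSel (Qw cd) (toVec cd z) s = ψ' s := fun s hs => hMS.flowSel_eq hsolz hs
  refine ⟨⟨flowSel_zero _, fun s hs => ?_⟩, fun s hs => by rw [heq s hs]; exact hbox' s hs⟩
  show HasDerivWithinAt (fun s => flowSel (Qw cd) (toVec cd z) s)
    (Qw cd (flowSel (Qw cd) (toVec cd z) s) (flowSel (Qw cd) (toVec cd z) s)) (Icc 0 (h - u₀)) s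
  rw [heq s hs]
  exact (hsolz.2 s hs).congr (fun σ hσ => heq σ hσ) (heq s hs)

/-- **(F3′b, existence)** A κ-restart from a point of a tube trajectory solves K1b-DR's ODE clause over the rest of the
sub-step. [folklore] -/
theorem solvesOn_liftFlowSel_restart
    (hMS : IsMajorantSystem (nW cd) (Qw cd) (wW cd j) (cd.bb j) (taylorJet (Qw cd)) (varJet (Qw cd)))
    (hu₀ : u₀ ∈ Icc 0 h) (hw : SolvesOn cd (fun _ => liftFlow cd (fun x s => flowSel (Qw cd) x s)) j w h)
    (htube : ∀ u ∈ Icc 0 h, ∀ i k, -cd.Kb ≤ k → k ≤ cd.Ka →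
      tlo i k ≤ stAt (fun _ => liftFlow cd (fun x s => flowSel (Qw cd) x s)) j w u i k ∧
        stAt (fun _ => liftFlow cd (fun x s => flowSel (Qw cd) x s)) j w u i k ≤ thi i k)
    (hz : cd.InBall j (z - stAt (fun _ => liftFlow cd (fun x s => flowSel (Qw cd) x s)) j w u₀) (cd.κ j))
    (hKκ : ∀ i k, -cd.Kb ≤ k → k ≤ cd.Ka → loK i k ≤ -(cd.κ j * cd.ω j k) ∧ cd.κ j * cd.ω j k ≤ hiK i k)
    (hencK : ∀ d₀ : Fin 4 → ℤ → ℝ, cd.InBall j d₀ (cd.κ j) → ∀ y d : Fin 4 → ℤ → ℝ,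
      (∀ i k, -cd.Kb ≤ k → k ≤ cd.Ka → tlo i k ≤ y i k ∧ y i k ≤ thi i k) →
      (∀ i k, -cd.Kb ≤ k → k ≤ cd.Ka → loK i k ≤ d i k ∧ d i k ≤ hiK i k) → ∀ u ∈ Icc (0:ℝ) h,
        ∀ i k, -cd.Kb ≤ k → k ≤ cd.Ka →
          loK i k ≤ (d₀ + u • (cd.Qb y d + cd.Qb d y + cd.Qb d d)) i k ∧
          (d₀ + u • (cd.Qb y d + cd.Qb d y + cd.Qb d d)) i k ≤ hiK i k) :
    SolvesOn cd (fun _ => liftFlow cd (fun x s => flowSel (Qw cd) x s)) j z (h - u₀) := by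
  have htube' : ∀ s ∈ Icc 0 h, flowSel (Qw cd) (toVec cd w) s ∈ Icc (toVec cd tlo) (toVec cd thi) := by
    intro s hs
    have h1 := toVec_mem_Icc_of_bounds (cd := cd) (htube s hs)
    rwa [stAt_liftFlow, toVec_ofVec] at h1
  have hz' : cd.InBall j (z - ofVec cd (flowSel (Qw cd) (toVec cd w) u₀)) (cd.κ j) := by
    rwa [stAt_liftFlow] at hz
  have hsol := (exists_restart_flowSel hMS hu₀ (isSolOn_flowSel_of_solvesOn hw) htube' hz' hKκ hencK).1
  intro i k hk1 hk2
  have hk : -cd.Kb ≤ k ∧ k ≤ cd.Ka := ⟨hk1, hk2⟩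
  refine ⟨liftFlowSel_zero z i hk, fun t' ht' => ?_⟩
  set c : Fin (nW cd) := eW cd (i, ⟨k, Finset.mem_Icc.2 hk⟩) with hc
  have hcomp : HasDerivWithinAt (fun s => flowSel (Qw cd) (toVec cd z) s c)
      (Qw cd (flowSel (Qw cd) (toVec cd z) t') (flowSel (Qw cd) (toVec cd z) t') c) (Icc 0 (h - u₀)) t' :=
    (hasDerivWithinAt_pi.1 (hsol.2 t' ht')) c
  have hfun : (fun s => liftFlow cd (fun x s => flowSel (Qw cd) x s) z i k s) =
      fun s => flowSel (Qw cd) (toVec cd z) s c := by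
    funext s; rw [liftFlow_of_mem z i hk]
  rw [show (fun _ => liftFlow cd (fun x s => flowSel (Qw cd) x s)) j z i k =
      fun s => liftFlow cd (fun x s => flowSel (Qw cd) x s) z i k s from rfl, hfun]
  convert hcomp using 1
  rw [quadTerm_trunc_eq_qT (cd := cd) _ i hk, qT_eq_Qw_apply (cd := cd) _ i hk]
  congr 1 <;>
  · funext c'
    simp only [toVec]
    rw [liftFlow_of_mem _ _ (shellOf_mem cd c')]
    congr 1
    exact (Equiv.apply_symm_apply (eW cd) c')

/-- **(F3′b, confinement)** … and its difference to the tube trajectory has window bounds in `[loK, hiK]`. [folklore] -/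
theorem diff_bounds_liftFlowSel_restart
    (hMS : IsMajorantSystem (nW cd) (Qw cd) (wW cd j) (cd.bb j) (taylorJet (Qw cd)) (varJet (Qw cd)))
    (hu₀ : u₀ ∈ Icc 0 h) (hw : SolvesOn cd (fun _ => liftFlow cd (fun x s => flowSel (Qw cd) x s)) j w h)
    (htube : ∀ u ∈ Icc 0 h, ∀ i k, -cd.Kb ≤ k → k ≤ cd.Ka →
      tlo i k ≤ stAt (fun _ => liftFlow cd (fun x s => flowSel (Qw cd) x s)) j w u i k ∧
        stAt (fun _ => liftFlow cd (fun x s => flowSel (Qw cd) x s)) j w u i k ≤ thi i k)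
    (hz : cd.InBall j (z - stAt (fun _ => liftFlow cd (fun x s => flowSel (Qw cd) x s)) j w u₀) (cd.κ j))
    (hKκ : ∀ i k, -cd.Kb ≤ k → k ≤ cd.Ka → loK i k ≤ -(cd.κ j * cd.ω j k) ∧ cd.κ j * cd.ω j k ≤ hiK i k)
    (hencK : ∀ d₀ : Fin 4 → ℤ → ℝ, cd.InBall j d₀ (cd.κ j) → ∀ y d : Fin 4 → ℤ → ℝ,
      (∀ i k, -cd.Kb ≤ k → k ≤ cd.Ka → tlo i k ≤ y i k ∧ y i k ≤ thi i k) →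
      (∀ i k, -cd.Kb ≤ k → k ≤ cd.Ka → loK i k ≤ d i k ∧ d i k ≤ hiK i k) → ∀ u ∈ Icc (0:ℝ) h,
        ∀ i k, -cd.Kb ≤ k → k ≤ cd.Ka →
          loK i k ≤ (d₀ + u • (cd.Qb y d + cd.Qb d y + cd.Qb d d)) i k ∧
          (d₀ + u • (cd.Qb y d + cd.Qb d y + cd.Qb d d)) i k ≤ hiK i k) :
    ∀ u ∈ Icc 0 (h - u₀), ∀ i k, -cd.Kb ≤ k → k ≤ cd.Ka →
      loK i k ≤ (stAt (fun _ => liftFlow cd (fun x s => flowSel (Qw cd) x s)) j z u -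
          stAt (fun _ => liftFlow cd (fun x s => flowSel (Qw cd) x s)) j w (u₀ + u)) i k ∧
      (stAt (fun _ => liftFlow cd (fun x s => flowSel (Qw cd) x s)) j z u -
          stAt (fun _ => liftFlow cd (fun x s => flowSel (Qw cd) x s)) j w (u₀ + u)) i k ≤ hiK i k := by
  have htube' : ∀ s ∈ Icc 0 h, flowSel (Qw cd) (toVec cd w) s ∈ Icc (toVec cd tlo) (toVec cd thi) := by
    intro s hs
    have h1 := toVec_mem_Icc_of_bounds (cd := cd) (htube s hs)
    rwa [stAt_liftFlow, toVec_ofVec] at h1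
  have hz' : cd.InBall j (z - ofVec cd (flowSel (Qw cd) (toVec cd w) u₀)) (cd.κ j) := by
    rwa [stAt_liftFlow] at hz
  intro u hu
  have hbox := (exists_restart_flowSel hMS hu₀ (isSolOn_flowSel_of_solvesOn hw) htube' hz' hKκ hencK).2 u hu
  rw [stAt_liftFlow, stAt_liftFlow, ← ofVec_sub]
  exact ofVec_window_bounds (cd := cd) hbox

end Restart

end Summit.NavierStokesRegularity.NavierStokesRegularity.Theorems.TaylorModelReadout

end
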